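import Literature.MathematicalPhysics.QuantumLattice.GrassmannGaussianAddition
import HarnessLib

/-!
# The fermionic Gaussian convolution and its semigroup property

Bauerschmidt–Brydges–Slade, CMP 337 (2015), arXiv:1403.7422, §5.1, Proposition 5.1:
"`E_{C'+C₁}θF = (E_{C'}θ ∘ E_{C₁}θ)F`" — Gaussian (super-)convolutions with covariances `C₁` and
`C'` compose to the Gaussian convolution with covariance `C' + C₁` ("for a proof see [BS-rg-norm]").
This file proves the FERMIONIC (Grassmann) part of this statement in the un-normalised algebraic
form of the tree's addition principle (`berezinOn_gaussian_fieldSum`, Benfatto–Giuliani–Mastropietro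
2006, (2.12)): for blocks of Grassmann generators `ψ₀ = e₀(·)` (the variable), `ψ₁ = e₁(·)`,
`ψ₂ = e₂(·)` (fluctuation fields) inside an ambient generator set `J`,

* `gaussConvOn R e₀ e₁ A x = ∫ dθ_{e₁} e^{ψ̄₁Aψ₁} x(ψ₀ + ψ₁)` — the (un-normalised) Gaussian
  convolution of `x` in the variable `ψ₀`, the fluctuation field being the block `e₁`
  (`berezinOn` after the substitution `1 + fieldShift e₀ e₁`, i.e. `ψ₀ ↦ ψ₀ + ψ₁`);
* `berezinOn_gaussian_fieldSum_spectator`: the addition principle of the tree extended to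
  integrands `g` carrying spectator fields (any generators outside the block `e₂`);
* **`gaussConvOn_gaussConvOn`** (three blocks): for `A⁻¹ = A₁⁻¹ + A₂⁻¹`,
  `Γ_{A₁}^{(1)} (Γ_{A₂}^{(2)} x) = (ε det A₁ det A₂ (det A)⁻¹) • Γ_A^{(1)} x` — convolving with
  covariance `A₂⁻¹` and then with `A₁⁻¹` is convolving with `A₁⁻¹ + A₂⁻¹`, up to the Gaussian
  normalisations `∫dθ e^{ψ̄Bψ} = ε det B`;
* **`gaussConvOn_gaussConvOn_inl_inr`** (two blocks): the same identity inside the doubled algebra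
  on `(ι ⊕ₗ ι) ⊕ₗ (ι ⊕ₗ ι)` (variable block `inlLex`, one fluctuation block `inrLex` used twice),
  obtained by transport to three blocks — the form in which it is used for the supersymmetric
  field theory representation of the weakly self-avoiding walk.

Everything is proved; no named facts.
-/

noncomputable section

namespace Literature.MathematicalPhysics.QuantumLattice

section QLatticeAQFT

open ExteriorAlgebra GrassmannAlgebra

/-! ### Shifts of spectators commute with partial Berezin integration -/

namespace GrassmannAlgebra

variable (R : Type*) [CommRing R] {J : Type*} [LinearOrder J] [Fintype J]

/-- **A substitution acting only on spectators commutes with `∫ dθ_s`**: if `N` kills the integrated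
generators (`j ∈ s`) and maps every generator into the span of the spectator generators, then
`∫ dθ_s (1+N)_* x = (1+N)_* ∫ dθ_s x`. [folklore] -/
theorem berezinOn_map_one_add_of_forall {s : Finset J} {N : Module.End R (J → R)}
    (h1 : ∀ j ∈ s, N (Pi.single j 1) = 0) (h2 : ∀ j, ∀ i ∈ s, N (Pi.single j 1) i = 0)
    (x : GrassmannAlgebra R J) :
    berezinOn R s (ExteriorAlgebra.map (1 + N) x) = ExteriorAlgebra.map (1 + N) (berezinOn R s x) := by
  suffices h : berezinOn R s ∘ₗ (ExteriorAlgebra.map (1 + N)).toLinearMap =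
      (ExteriorAlgebra.map (1 + N)).toLinearMap ∘ₗ berezinOn R s from LinearMap.congr_fun h x
  refine (grassmannBasis R J).ext fun t => ?_
  rw [LinearMap.comp_apply, LinearMap.comp_apply, AlgHom.toLinearMap_apply, AlgHom.toLinearMap_apply]
  -- the spectator part of `θ_t` is moved by `1 + N` inside the spectators; the integrated part is fixed
  have hfix : ExteriorAlgebra.map (1 + N) (grassmannBasis R J (t ∩ s)) = grassmannBasis R J (t ∩ s) := by
    rw [grassmannBasis_eq_prod_map_gen, map_list_prod, List.map_map]
    congr 1
    refine List.map_congr_left fun j hj => ?_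
    have hjs : j ∈ s := (Finset.mem_inter.1 ((Finset.mem_sort _).1 hj)).2
    rw [Function.comp_apply, map_one_add_gen, h1 j hjs, map_zero, add_zero]
  have hspec : ExteriorAlgebra.map (1 + N) (grassmannBasis R J (t \ s)) ∈ spectatorSubalgebra R s := by
    rw [grassmannBasis_eq_prod_map_gen, map_list_prod, List.map_map]
    refine Subalgebra.list_prod_mem _ fun y hy => ?_
    obtain ⟨j, hj, rfl⟩ := List.mem_map.1 hy
    have hjs : j ∉ s := (Finset.mem_sdiff.1 ((Finset.mem_sort _).1 hj)).2
    rw [Function.comp_apply, map_one_add_gen]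
    exact Subalgebra.add_mem _ (gen_mem_spectatorSubalgebra R hjs)
      (ι_mem_spectatorSubalgebra R fun i hi => h2 j i hi)
  have hempty : (t ∩ s) \ s = ∅ := Finset.sdiff_eq_empty_iff_subset.2 Finset.inter_subset_right
  rw [grassmannBasis_eq_smul_sdiff_mul_inter R t s, map_smul, map_mul, hfix, map_smul, map_smul,
    berezinOn_mul_of_mem_spectatorSubalgebra R hspec,
    berezinOn_mul_of_mem_spectatorSubalgebra R (grassmannBasis_mem_spectatorSubalgebra R Finset.sdiff_disjoint),
    map_smul, map_mul, berezinOn_grassmannBasis]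
  by_cases hst : s ⊆ t ∩ s
  · rw [if_pos hst, map_smul, hempty, grassmannBasis_empty, map_one]
  · rw [if_neg hst, map_zero]

/-- Two substitutions `(1+N)_*`, `(1+N')_*` agree on the spectators of `s` as soon as `N` and `N'`
agree on the spectator generators. [folklore] -/
theorem map_one_add_eq_of_mem_spectatorSubalgebra {s : Finset J} {N N' : Module.End R (J → R)}
    (h : ∀ j ∉ s, N (Pi.single j 1) = N' (Pi.single j 1)) {x : GrassmannAlgebra R J}
    (hx : x ∈ spectatorSubalgebra R s) :
    ExteriorAlgebra.map (1 + N) x = ExteriorAlgebra.map (1 + N') x := by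
  rw [spectatorSubalgebra_eq_adjoin] at hx
  induction hx using Algebra.adjoin_induction with
  | mem y hy =>
    obtain ⟨j, hj, rfl⟩ := hy
    rw [map_one_add_gen, map_one_add_gen, h j hj]
  | algebraMap r => rw [AlgHom.commutes, AlgHom.commutes]
  | mul y z _ _ hy hz => rw [map_mul, map_mul, hy, hz]
  | add y z _ _ hy hz => rw [map_add, map_add, hy, hz]

/-- Two ring homomorphisms out of a Grassmann algebra that agree on the scalars and on the spectator
generators of `s` agree on the spectators of `s`. [folklore] -/
theorem ringHom_eq_of_mem_spectatorSubalgebra {S : Type*} [Semiring S] {s : Finset J}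
    {f g : GrassmannAlgebra R J →+* S} (h0 : ∀ r : R, f (algebraMap R _ r) = g (algebraMap R _ r))
    (h : ∀ j ∉ s, f (gen R j) = g (gen R j)) {x : GrassmannAlgebra R J} (hx : x ∈ spectatorSubalgebra R s) :
    f x = g x := by
  rw [spectatorSubalgebra_eq_adjoin] at hx
  induction hx using Algebra.adjoin_induction with
  | mem y hy =>
    obtain ⟨j, hj, rfl⟩ := hy
    exact h j hj
  | algebraMap r => exact h0 r
  | mul y z _ _ hy hz => rw [map_mul, map_mul, hy, hz]
  | add y z _ _ hy hz => rw [map_add, map_add, hy, hz]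

end GrassmannAlgebra

/-! ### Algebra of the field-sum shifts of three blocks -/

section Shifts

variable (R : Type*) [CommRing R] {ι : Type*} [LinearOrder ι] [Fintype ι] {J : Type*} [LinearOrder J]

/-- `fieldShift e₀ e₂ ∘ fieldShift e₀ e₁ = 0` for disjoint blocks `e₀`, `e₁`. [folklore] -/
theorem fieldShift_comp_fieldShift_eq_zero (e₀ e₁ e₂ : ι ⊕ₗ ι ↪o J)
    (h01 : Disjoint (Finset.univ.map e₀.toEmbedding) (Finset.univ.map e₁.toEmbedding)) :
    fieldShift R e₀ e₂ ∘ₗ fieldShift R e₀ e₁ = 0 := by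
  refine LinearMap.ext fun w => ?_
  rw [LinearMap.comp_apply, LinearMap.zero_apply, fieldShift_apply R e₀ e₁, map_sum]
  refine Finset.sum_eq_zero fun k _ => ?_
  rw [map_smul, fieldShift_single_of_not_mem R e₀ e₂, smul_zero]
  exact fun h => Finset.disjoint_left.1 h01 h (Finset.mem_map_of_mem _ (Finset.mem_univ k))

/-- `fieldShift e₁ e₂ ∘ fieldShift e₀ e₁ = fieldShift e₀ e₂`. [folklore] -/
theorem fieldShift_comp_fieldShift_eq (e₀ e₁ e₂ : ι ⊕ₗ ι ↪o J) :
    fieldShift R e₁ e₂ ∘ₗ fieldShift R e₀ e₁ = fieldShift R e₀ e₂ := by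
  refine LinearMap.ext fun w => ?_
  rw [LinearMap.comp_apply, fieldShift_apply R e₀ e₁, map_sum, fieldShift_apply R e₀ e₂]
  refine Finset.sum_congr rfl fun k _ => ?_
  rw [map_smul, fieldShift_single_apply_range]

/-- **`(ψ₀ ↦ ψ₀+ψ₂)` then `(ψ₀ ↦ ψ₀+ψ₁)` is `ψ₀ ↦ ψ₀+ψ₁+ψ₂`** (blocks `e₀`, `e₂` disjoint). [folklore] -/
theorem map_one_add_fieldShift_map_one_add_fieldShift (e₀ e₁ e₂ : ι ⊕ₗ ι ↪o J)
    (h02 : Disjoint (Finset.univ.map e₀.toEmbedding) (Finset.univ.map e₂.toEmbedding))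
    (x : GrassmannAlgebra R J) :
    ExteriorAlgebra.map (1 + fieldShift R e₀ e₁) (ExteriorAlgebra.map (1 + fieldShift R e₀ e₂) x) =
      ExteriorAlgebra.map (1 + (fieldShift R e₀ e₁ + fieldShift R e₀ e₂)) x := by
  rw [← AlgHom.comp_apply, ExteriorAlgebra.map_comp_map]
  congr 2
  refine LinearMap.ext fun w => ?_
  have h0 : fieldShift R e₀ e₁ (fieldShift R e₀ e₂ w) = 0 :=
    LinearMap.congr_fun (fieldShift_comp_fieldShift_eq_zero R e₀ e₂ e₁ h02) w
  simp only [LinearMap.comp_apply, LinearMap.add_apply, Module.End.one_apply, map_add, h0, add_zero]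
  abel

/-- **`(ψ₀ ↦ ψ₀+ψ₁)` then `(ψ₁ ↦ ψ₁+ψ₂)` is `ψ₀ ↦ ψ₀+ψ₁+ψ₂` on forms without `ψ₁`**. [folklore] -/
theorem map_one_add_fieldShift₁₂_map_one_add_fieldShift₀₁ [Fintype J] (e₀ e₁ e₂ : ι ⊕ₗ ι ↪o J)
    {x : GrassmannAlgebra R J} (hx : x ∈ spectatorSubalgebra R (Finset.univ.map e₁.toEmbedding)) :
    ExteriorAlgebra.map (1 + fieldShift R e₁ e₂) (ExteriorAlgebra.map (1 + fieldShift R e₀ e₁) x) =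
      ExteriorAlgebra.map (1 + (fieldShift R e₀ e₁ + fieldShift R e₀ e₂)) x := by
  have hcomp : (1 + fieldShift R e₁ e₂) ∘ₗ (1 + fieldShift R e₀ e₁) =
      1 + (fieldShift R e₀ e₁ + fieldShift R e₀ e₂ + fieldShift R e₁ e₂) := by
    refine LinearMap.ext fun w => ?_
    have h0 : fieldShift R e₁ e₂ (fieldShift R e₀ e₁ w) = fieldShift R e₀ e₂ w :=
      LinearMap.congr_fun (fieldShift_comp_fieldShift_eq R e₀ e₁ e₂) w
    simp only [LinearMap.comp_apply, LinearMap.add_apply, Module.End.one_apply, map_add, h0]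
    abel
  rw [← AlgHom.comp_apply, ExteriorAlgebra.map_comp_map, hcomp]
  refine map_one_add_eq_of_mem_spectatorSubalgebra R (fun j hj => ?_) hx
  simp only [LinearMap.add_apply, fieldShift_single_of_not_mem R e₁ e₂ hj, add_zero]

/-- The substitution `ψ_a ↦ ψ_a + ψ_b` keeps forms without `t`-generators free of them when the block
`b` avoids `t`. [folklore] -/
theorem map_one_add_fieldShift_mem_spectatorSubalgebra [Fintype J] (ea eb : ι ⊕ₗ ι ↪o J) {t : Finset J}
    (hb : ∀ k, eb k ∉ t) {x : GrassmannAlgebra R J} (hx : x ∈ spectatorSubalgebra R t) :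
    ExteriorAlgebra.map (1 + fieldShift R ea eb) x ∈ spectatorSubalgebra R t := by
  rw [spectatorSubalgebra_eq_adjoin] at hx ⊢
  induction hx using Algebra.adjoin_induction with
  | mem y hy =>
    obtain ⟨j, hj, rfl⟩ := hy
    by_cases hja : j ∈ Finset.univ.map ea.toEmbedding
    · obtain ⟨k, -, rfl⟩ := Finset.mem_map.1 hja
      change ExteriorAlgebra.map _ (gen R (ea k)) ∈ _
      rw [map_one_add_fieldShift_gen_range]
      exact Subalgebra.add_mem _ (Algebra.subset_adjoin ⟨ea k, hj, rfl⟩) (Algebra.subset_adjoin ⟨eb k, hb k, rfl⟩)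
    · rw [map_one_add_fieldShift_gen_of_not_mem R ea eb hja]
      exact Algebra.subset_adjoin ⟨j, hj, rfl⟩
  | algebraMap r => rw [AlgHom.commutes]; exact Subalgebra.algebraMap_mem _ r
  | mul y z _ _ hy hz => rw [map_mul]; exact Subalgebra.mul_mem _ hy hz
  | add y z _ _ hy hz => rw [map_add]; exact Subalgebra.add_mem _ hy hz

/-- The embedding along `f` maps the spectators of `s` into the spectators of any `t` avoided by
`f(sᶜ)`. [folklore] -/
theorem map_extendByZero_mem_spectatorSubalgebra_of_mem [Fintype J] {J' : Type*} [LinearOrder J'] [Fintype J']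
    (f : J ↪o J') {s : Finset J} {t : Finset J'}
    (hst : ∀ j ∉ s, f j ∉ t) {x : GrassmannAlgebra R J} (hx : x ∈ spectatorSubalgebra R s) :
    ExteriorAlgebra.map (Function.ExtendByZero.linearMap R f) x ∈ spectatorSubalgebra R t := by
  rw [spectatorSubalgebra_eq_adjoin] at hx ⊢
  induction hx using Algebra.adjoin_induction with
  | mem y hy =>
    obtain ⟨j, hj, rfl⟩ := hy
    rw [map_extendByZero_gen]
    exact Algebra.subset_adjoin ⟨f j, hst j hj, rfl⟩
  | algebraMap r => rw [AlgHom.commutes]; exact Subalgebra.algebraMap_mem _ r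
  | mul y z _ _ hy hz => rw [map_mul]; exact Subalgebra.mul_mem _ hy hz
  | add y z _ _ hy hz => rw [map_add]; exact Subalgebra.add_mem _ hy hz

end Shifts

/-! ### The fermionic Gaussian convolution -/

section Convolution

variable (R : Type*) [CommRing R] [Algebra ℚ R] {ι : Type*} [LinearOrder ι] [Fintype ι]
  {J : Type*} [LinearOrder J] [Fintype J] {J' : Type*} [LinearOrder J'] [Fintype J']

/-- **The (un-normalised) fermionic Gaussian convolution** in the variable block `ψ₀ = e₀(·)` with
fluctuation block `ψ₁ = e₁(·)` and weight `e^{ψ̄₁Aψ₁}`: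
`Γ x = ∫ dθ_{e₁} e^{ψ̄₁Aψ₁} x(ψ₀ + ψ₁)`; dividing by `∫ dθ e^{ψ̄Aψ} = ε det A` this is the Grassmann
Gaussian expectation of `x(ψ₀+ψ₁)` in `ψ₁` with covariance `A⁻¹` — the fermionic part of `E_Cθ`
(BBS 2015, (4.21)–(4.23)). [cite: BauerschmidtBrydgesSlade2015LogCorr, §4.1 eqs. (4.21)-(4.23) and §5.1 Proposition 5.1] -/
def gaussConvOn (e₀ e₁ : ι ⊕ₗ ι ↪o J) (A : Matrix ι ι R) (x : GrassmannAlgebra R J) : GrassmannAlgebra R J :=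
  berezinOn R (Finset.univ.map e₁.toEmbedding)
    (ExteriorAlgebra.map (Function.ExtendByZero.linearMap R e₁) (grassmannExp (quadratic R A)) *
      ExteriorAlgebra.map (1 + fieldShift R e₀ e₁) x)

omit [Fintype J] [Fintype J'] in
/-- The block of `e.trans f` is the `f`-image of the block of `e`. [folklore] -/
theorem map_univ_trans (e : ι ⊕ₗ ι ↪o J) (f : J ↪o J') :
    (Finset.univ.map e.toEmbedding).map f.toEmbedding = Finset.univ.map (e.trans f).toEmbedding := by
  rw [Finset.map_map]; rfl

/-- **Transport of `Γ` along an order embedding of the ambient generators.** [folklore] -/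
theorem map_extendByZero_gaussConvOn (e₀ e₁ : ι ⊕ₗ ι ↪o J) (f : J ↪o J') (A : Matrix ι ι R)
    (x : GrassmannAlgebra R J) :
    ExteriorAlgebra.map (Function.ExtendByZero.linearMap R f) (gaussConvOn R e₀ e₁ A x) =
      gaussConvOn R (e₀.trans f) (e₁.trans f) A (ExteriorAlgebra.map (Function.ExtendByZero.linearMap R f) x) := by
  rw [gaussConvOn, gaussConvOn, ← map_univ_trans, ← berezinOn_map_map_extendByZero, map_mul,
    map_extendByZero_map_extendByZero, map_extendByZero_map_one_add_fieldShift]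

/-- `Γ x` has no fluctuation fields left. [folklore] -/
theorem gaussConvOn_mem_self (e₀ e₁ : ι ⊕ₗ ι ↪o J) (A : Matrix ι ι R) (x : GrassmannAlgebra R J) :
    gaussConvOn R e₀ e₁ A x ∈ spectatorSubalgebra R (Finset.univ.map e₁.toEmbedding) :=
  berezinOn_mem_spectatorSubalgebra_self R _ _

/-- `Γ` does not create generators of a set `t` avoided by the fluctuation block. [folklore] -/
theorem gaussConvOn_mem (e₀ e₁ : ι ⊕ₗ ι ↪o J) (A : Matrix ι ι R) {t : Finset J} (h1 : ∀ k, e₁ k ∉ t)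
    {x : GrassmannAlgebra R J} (hx : x ∈ spectatorSubalgebra R t) :
    gaussConvOn R e₀ e₁ A x ∈ spectatorSubalgebra R t := by
  show berezinOn R _ _ ∈ _
  have h := berezinOn_mem_spectatorSubalgebra R (s := Finset.univ.map e₁.toEmbedding)
    (Subalgebra.mul_mem _ (map_extendByZero_mem_spectatorSubalgebra R e₁ h1 (grassmannExp (quadratic R A)))
      (map_one_add_fieldShift_mem_spectatorSubalgebra R e₀ e₁ h1 hx))
  exact spectatorSubalgebra_mono R (s := t) (s' := t ∪ Finset.univ.map e₁.toEmbedding) Finset.subset_union_left h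

/-- **The addition principle with spectators**: the tree's `berezinOn_gaussian_fieldSum` for
integrands `g` that may contain any generators outside the second block `e₂` (not only the
`ψ₁`-fields): `∫ dθ_{s₁∪s₂} e^{ψ̄₁A₁ψ₁} e^{ψ̄₂A₂ψ₂} g(ψ₁ + ψ₂) = (ε det A₁ det A₂ (det A)⁻¹) ∫ dθ_{s₁} e^{ψ̄₁Aψ₁} g(ψ₁)`
(`A⁻¹ = A₁⁻¹ + A₂⁻¹`; both sides are linear over the spectator monomials, which pass through the
substitution, the central Gaussian weights and the integral). [cite: BenfattoGiulianiMastropietro2006, (2.12)] -/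
theorem berezinOn_gaussian_fieldSum_spectator (e₁ e₂ : ι ⊕ₗ ι ↪o J)
    (h12 : ∀ x ∈ Finset.univ.map e₁.toEmbedding, ∀ y ∈ Finset.univ.map e₂.toEmbedding, x < y)
    (A₁ A₂ A : Matrix ι ι R) (hA₁ : IsUnit A₁.det) (hA₂ : IsUnit A₂.det) (hA : IsUnit A.det)
    (hAinv : A⁻¹ = A₁⁻¹ + A₂⁻¹) {g : GrassmannAlgebra R J}
    (hg : g ∈ spectatorSubalgebra R (Finset.univ.map e₂.toEmbedding)) :
    berezinOn R (Finset.univ.map e₁.toEmbedding ∪ Finset.univ.map e₂.toEmbedding)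
        (ExteriorAlgebra.map (Function.ExtendByZero.linearMap R e₁) (grassmannExp (quadratic R A₁)) *
          ExteriorAlgebra.map (Function.ExtendByZero.linearMap R e₂) (grassmannExp (quadratic R A₂)) *
          ExteriorAlgebra.map (1 + fieldShift R e₁ e₂) g) =
      ((-1 : R) ^ (Fintype.card ι * (Fintype.card ι - 1) / 2) * A₁.det * A₂.det * Ring.inverse A.det) •
        berezinOn R (Finset.univ.map e₁.toEmbedding)
          (ExteriorAlgebra.map (Function.ExtendByZero.linearMap R e₁) (grassmannExp (quadratic R A)) * g) := by
  have hdisj : Disjoint (Finset.univ.map e₁.toEmbedding) (Finset.univ.map e₂.toEmbedding) :=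
    Finset.disjoint_left.2 fun a ha hb => lt_irrefl a (h12 a ha a hb)
  -- both sides are `R`-linear in `g`: check on the spectator monomials `θ_w`, `w ∩ s₂ = ∅`
  suffices h : ∀ w : Finset J, Disjoint w (Finset.univ.map e₂.toEmbedding) →
      berezinOn R (Finset.univ.map e₁.toEmbedding ∪ Finset.univ.map e₂.toEmbedding)
        (ExteriorAlgebra.map (Function.ExtendByZero.linearMap R e₁) (grassmannExp (quadratic R A₁)) *
          ExteriorAlgebra.map (Function.ExtendByZero.linearMap R e₂) (grassmannExp (quadratic R A₂)) *
          ExteriorAlgebra.map (1 + fieldShift R e₁ e₂) (grassmannBasis R J w)) =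
        ((-1 : R) ^ (Fintype.card ι * (Fintype.card ι - 1) / 2) * A₁.det * A₂.det * Ring.inverse A.det) •
          berezinOn R (Finset.univ.map e₁.toEmbedding)
            (ExteriorAlgebra.map (Function.ExtendByZero.linearMap R e₁) (grassmannExp (quadratic R A)) *
              grassmannBasis R J w) by
    rw [mem_spectatorSubalgebra_iff] at hg
    induction hg using Submodule.span_induction with
    | mem y hy =>
      obtain ⟨w, hw, rfl⟩ := hy
      exact h w hw
    | zero => rw [map_zero, mul_zero, map_zero, mul_zero, map_zero, smul_zero]
    | add y z _ _ hy hz => rw [map_add, mul_add, map_add, hy, hz, mul_add, map_add, smul_add]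
    | smul r y _ hy => rw [map_smul, mul_smul_comm, map_smul, hy, mul_smul_comm, map_smul, smul_comm]
  intro w hw
  -- split `θ_w = ± θ_{w ∖ s₁} θ_{w ∩ s₁}` into its spectator part and its `ψ₁`-part
  have hw's₂ : Disjoint (w \ Finset.univ.map e₁.toEmbedding) (Finset.univ.map e₂.toEmbedding) :=
    Finset.disjoint_of_subset_left Finset.sdiff_subset hw
  have hw'spec₁ : grassmannBasis R J (w \ Finset.univ.map e₁.toEmbedding) ∈
      spectatorSubalgebra R (Finset.univ.map e₁.toEmbedding) :=
    grassmannBasis_mem_spectatorSubalgebra R Finset.sdiff_disjoint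
  have hw'spec₁₂ : grassmannBasis R J (w \ Finset.univ.map e₁.toEmbedding) ∈
      spectatorSubalgebra R (Finset.univ.map e₁.toEmbedding ∪ Finset.univ.map e₂.toEmbedding) :=
    grassmannBasis_mem_spectatorSubalgebra R (Finset.disjoint_union_right.2 ⟨Finset.sdiff_disjoint, hw's₂⟩)
  have hw₁ψ : grassmannBasis R J (w ∩ Finset.univ.map e₁.toEmbedding) ∈
      spectatorSubalgebra R (Finset.univ.map e₁.toEmbedding)ᶜ :=
    grassmannBasis_mem_spectatorSubalgebra R
      (Finset.disjoint_left.2 fun a ha hc' => (Finset.mem_compl.1 hc') (Finset.mem_inter.1 ha).2)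
  have hshift : ExteriorAlgebra.map (1 + fieldShift R e₁ e₂)
      (grassmannBasis R J (w \ Finset.univ.map e₁.toEmbedding) *
        grassmannBasis R J (w ∩ Finset.univ.map e₁.toEmbedding)) =
      grassmannBasis R J (w \ Finset.univ.map e₁.toEmbedding) *
        ExteriorAlgebra.map (1 + fieldShift R e₁ e₂) (grassmannBasis R J (w ∩ Finset.univ.map e₁.toEmbedding)) := by
    rw [map_mul, (isSpectatorShift_fieldShift R e₁ e₂ hdisj).map_eq_self_of_mem R hw'spec₁]
  have hcomm₁₂ : Commute
      (ExteriorAlgebra.map (Function.ExtendByZero.linearMap R e₁) (grassmannExp (quadratic R A₁)) *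
        ExteriorAlgebra.map (Function.ExtendByZero.linearMap R e₂) (grassmannExp (quadratic R A₂)))
      (grassmannBasis R J (w \ Finset.univ.map e₁.toEmbedding)) :=
    Commute.mul_left (commute_map_extend_grassmannExp_quadratic R e₁ A₁ _)
      (commute_map_extend_grassmannExp_quadratic R e₂ A₂ _)
  have hcommA : Commute (ExteriorAlgebra.map (Function.ExtendByZero.linearMap R e₁) (grassmannExp (quadratic R A)))
      (grassmannBasis R J (w \ Finset.univ.map e₁.toEmbedding)) :=
    commute_map_extend_grassmannExp_quadratic R e₁ A _
  have key := berezinOn_gaussian_fieldSum R e₁ e₂ h12 A₁ A₂ A hA₁ hA₂ hA hAinv hw₁ψ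
  rw [grassmannBasis_eq_smul_sdiff_mul_inter R w (Finset.univ.map e₁.toEmbedding), map_smul, mul_smul_comm,
    map_smul, hshift, hcomm₁₂.left_comm, berezinOn_mul_of_mem_spectatorSubalgebra R hw'spec₁₂,
    key, mul_smul_comm, mul_smul_comm, map_smul, hcommA.left_comm,
    berezinOn_mul_of_mem_spectatorSubalgebra R hw'spec₁, smul_comm]

/-- **The fermionic convolution semigroup (three blocks)**: for blocks `e₀` (variable), `e₁ < e₂`
(fluctuation fields), `A⁻¹ = A₁⁻¹ + A₂⁻¹` with `det A₁, det A₂, det A` units, and every `x` without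
`ψ₁`- and `ψ₂`-fields,
`∫ dθ_{e₁} e^{ψ̄₁A₁ψ₁} (∫ dθ_{e₂} e^{ψ̄₂A₂ψ₂} x(ψ₀+ψ₂))(ψ₀ ↦ ψ₀+ψ₁) = (ε det A₁ det A₂ (det A)⁻¹) ∫ dθ_{e₁} e^{ψ̄₁Aψ₁} x(ψ₀+ψ₁)`,
i.e. the Gaussian convolution with covariance `A₂⁻¹` followed by the one with covariance `A₁⁻¹` is the
Gaussian convolution with covariance `A₁⁻¹ + A₂⁻¹` (normalised: BBS 2015, Proposition 5.1,
`E_{C'+C₁}θ = E_{C'}θ ∘ E_{C₁}θ`, fermionic part). [cite: BauerschmidtBrydgesSlade2015LogCorr, §5.1, Proposition 5.1] -/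
theorem gaussConvOn_gaussConvOn (e₀ e₁ e₂ : ι ⊕ₗ ι ↪o J)
    (h01 : Disjoint (Finset.univ.map e₀.toEmbedding) (Finset.univ.map e₁.toEmbedding))
    (h02 : Disjoint (Finset.univ.map e₀.toEmbedding) (Finset.univ.map e₂.toEmbedding))
    (h12 : ∀ x ∈ Finset.univ.map e₁.toEmbedding, ∀ y ∈ Finset.univ.map e₂.toEmbedding, x < y)
    (A₁ A₂ A : Matrix ι ι R) (hA₁ : IsUnit A₁.det) (hA₂ : IsUnit A₂.det) (hA : IsUnit A.det)
    (hAinv : A⁻¹ = A₁⁻¹ + A₂⁻¹) {x : GrassmannAlgebra R J}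
    (hx₁ : x ∈ spectatorSubalgebra R (Finset.univ.map e₁.toEmbedding))
    (hx₂ : x ∈ spectatorSubalgebra R (Finset.univ.map e₂.toEmbedding)) :
    gaussConvOn R e₀ e₁ A₁ (gaussConvOn R e₀ e₂ A₂ x) =
      ((-1 : R) ^ (Fintype.card ι * (Fintype.card ι - 1) / 2) * A₁.det * A₂.det * Ring.inverse A.det) •
        gaussConvOn R e₀ e₁ A x := by
  have hdisj : Disjoint (Finset.univ.map e₁.toEmbedding) (Finset.univ.map e₂.toEmbedding) :=
    Finset.disjoint_left.2 fun a ha hb => lt_irrefl a (h12 a ha a hb)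
  have he₁s₂ : ∀ k, e₁ k ∉ Finset.univ.map e₂.toEmbedding := fun k hk =>
    Finset.disjoint_left.1 hdisj (Finset.mem_map_of_mem _ (Finset.mem_univ k)) hk
  have he₂s₀ : ∀ k, e₂ k ∉ Finset.univ.map e₀.toEmbedding := fun k hk =>
    Finset.disjoint_right.1 h02 (Finset.mem_map_of_mem _ (Finset.mem_univ k)) hk
  have hE₂s₀ : ExteriorAlgebra.map (Function.ExtendByZero.linearMap R e₂) (grassmannExp (quadratic R A₂)) ∈
      spectatorSubalgebra R (Finset.univ.map e₀.toEmbedding) :=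
    map_extendByZero_mem_spectatorSubalgebra R e₂ he₂s₀ _
  have hE₁s₂ : ExteriorAlgebra.map (Function.ExtendByZero.linearMap R e₁) (grassmannExp (quadratic R A₁)) ∈
      spectatorSubalgebra R (Finset.univ.map e₂.toEmbedding) :=
    map_extendByZero_mem_spectatorSubalgebra R e₁ he₁s₂ _
  -- Step 1: the substitution `ψ₀ ↦ ψ₀ + ψ₁` commutes with `∫ dθ_{e₂}` and fixes `e^{ψ̄₂A₂ψ₂}`
  have hN1 : ∀ j ∈ Finset.univ.map e₂.toEmbedding, fieldShift R e₀ e₁ (Pi.single j 1) = 0 := fun j hj =>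
    fieldShift_single_of_not_mem R e₀ e₁ fun hj₀ => Finset.disjoint_left.1 h02 hj₀ hj
  have hN2 : ∀ j, ∀ i ∈ Finset.univ.map e₂.toEmbedding, fieldShift R e₀ e₁ (Pi.single j 1) i = 0 := by
    intro j i hi
    rw [fieldShift_apply, Finset.sum_apply]
    refine Finset.sum_eq_zero fun k _ => ?_
    rw [Pi.smul_apply, show (Pi.single (e₁ k) (1 : R) : J → R) i = 0 from
      Pi.single_eq_of_ne (fun h => he₁s₂ k (by rw [← h]; exact hi)) _, smul_zero]
  have step1 : ExteriorAlgebra.map (1 + fieldShift R e₀ e₁) (gaussConvOn R e₀ e₂ A₂ x) =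
      berezinOn R (Finset.univ.map e₂.toEmbedding)
        (ExteriorAlgebra.map (Function.ExtendByZero.linearMap R e₂) (grassmannExp (quadratic R A₂)) *
          ExteriorAlgebra.map (1 + (fieldShift R e₀ e₁ + fieldShift R e₀ e₂)) x) := by
    rw [gaussConvOn, ← berezinOn_map_one_add_of_forall R hN1 hN2, map_mul,
      (isSpectatorShift_fieldShift R e₀ e₁ h01).map_eq_self_of_mem R hE₂s₀,
      map_one_add_fieldShift_map_one_add_fieldShift R e₀ e₁ e₂ h02]
  -- Step 2: Fubini for the two blocks and the addition principle
  have hg : ExteriorAlgebra.map (1 + fieldShift R e₀ e₁) x ∈ spectatorSubalgebra R (Finset.univ.map e₂.toEmbedding) :=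
    map_one_add_fieldShift_mem_spectatorSubalgebra R e₀ e₁ he₁s₂ hx₂
  rw [gaussConvOn, step1, (berezinOn_mul_of_mem_spectatorSubalgebra R hE₁s₂ _).symm,
    berezinOn_berezinOn_of_forall_lt R h12, ← mul_assoc,
    ← map_one_add_fieldShift₁₂_map_one_add_fieldShift₀₁ R e₀ e₁ e₂ hx₁,
    berezinOn_gaussian_fieldSum_spectator R e₁ e₂ h12 A₁ A₂ A hA₁ hA₂ hA hAinv hg, gaussConvOn]

end Convolution

/-! ### Two blocks: the doubled algebra `(ι ⊕ₗ ι) ⊕ₗ (ι ⊕ₗ ι)` -/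

section Indices

/-- Lift an order embedding to the right summand of a lexicographic sum. [folklore] -/
def liftRightLex (K₁ : Type*) [LinearOrder K₁] {K₂ K : Type*} [LinearOrder K₂] [LinearOrder K] (g : K₂ ↪o K) :
    K₁ ⊕ₗ K₂ ↪o K₁ ⊕ₗ K :=
  OrderEmbedding.ofStrictMono (fun x => toLex (Sum.map id g (ofLex x))) (by
    have h : ∀ u v : K₁ ⊕ K₂, toLex u < toLex v → toLex (Sum.map id g u) < toLex (Sum.map id g v) := by
      rintro (u | u) (v | v) huv
      · exact Sum.Lex.inl_lt_inl_iff.2 (Sum.Lex.inl_lt_inl_iff.1 huv)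
      · exact Sum.Lex.inl_lt_inr _ _
      · exact absurd huv Sum.Lex.not_inr_lt_inl
      · exact Sum.Lex.inr_lt_inr_iff.2 (g.strictMono (Sum.Lex.inr_lt_inr_iff.1 huv))
    exact fun a b hab => h (ofLex a) (ofLex b) hab)

variable (κ : Type*) [LinearOrder κ]

/-- The doubled generator set: the variable block `ψ̄, ψ` and one fluctuation block `η̄, η`. [folklore] -/
abbrev DblIdx : Type _ := (κ ⊕ₗ κ) ⊕ₗ (κ ⊕ₗ κ)

/-- The tripled generator set used in the proof: `ψ`, `η₁`, `η₂`. [folklore] -/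
abbrev TrpIdx : Type _ := (κ ⊕ₗ κ) ⊕ₗ ((κ ⊕ₗ κ) ⊕ₗ (κ ⊕ₗ κ))

/-- The variable block of the doubled set. [folklore] -/
def dblPsi : (κ ⊕ₗ κ) ↪o DblIdx κ := inlLex (κ ⊕ₗ κ) (κ ⊕ₗ κ)

/-- The fluctuation block of the doubled set. [folklore] -/
def dblEta : (κ ⊕ₗ κ) ↪o DblIdx κ := inrLex (κ ⊕ₗ κ) (κ ⊕ₗ κ)

/-- The variable block of the tripled set. [folklore] -/
def trpPsi : (κ ⊕ₗ κ) ↪o TrpIdx κ := inlLex (κ ⊕ₗ κ) ((κ ⊕ₗ κ) ⊕ₗ (κ ⊕ₗ κ))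

/-- The first fluctuation block of the tripled set. [folklore] -/
def trpEta₁ : (κ ⊕ₗ κ) ↪o TrpIdx κ :=
  (inlLex (κ ⊕ₗ κ) (κ ⊕ₗ κ)).trans (inrLex (κ ⊕ₗ κ) ((κ ⊕ₗ κ) ⊕ₗ (κ ⊕ₗ κ)))

/-- The second fluctuation block of the tripled set. [folklore] -/
def trpEta₂ : (κ ⊕ₗ κ) ↪o TrpIdx κ :=
  (inrLex (κ ⊕ₗ κ) (κ ⊕ₗ κ)).trans (inrLex (κ ⊕ₗ κ) ((κ ⊕ₗ κ) ⊕ₗ (κ ⊕ₗ κ)))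

/-- `(ψ, η) ↦ (ψ, η₁)`. [folklore] -/
def dblEmb₁ : DblIdx κ ↪o TrpIdx κ := liftRightLex (κ ⊕ₗ κ) (inlLex (κ ⊕ₗ κ) (κ ⊕ₗ κ))

/-- `(ψ, η) ↦ (ψ, η₂)`. [folklore] -/
def dblEmb₂ : DblIdx κ ↪o TrpIdx κ := liftRightLex (κ ⊕ₗ κ) (inrLex (κ ⊕ₗ κ) (κ ⊕ₗ κ))

/-- Both embeddings restrict to the variable block as `trpPsi`. [folklore] -/
theorem dblPsi_trans_dblEmb₁ : (dblPsi κ).trans (dblEmb₁ κ) = trpPsi κ := by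
  ext k; rfl

/-- Both embeddings restrict to the variable block as `trpPsi`. [folklore] -/
theorem dblPsi_trans_dblEmb₂ : (dblPsi κ).trans (dblEmb₂ κ) = trpPsi κ := by
  ext k; rfl

/-- The fluctuation block goes to `η₁` under the first embedding. [folklore] -/
theorem dblEta_trans_dblEmb₁ : (dblEta κ).trans (dblEmb₁ κ) = trpEta₁ κ := by
  ext k; rfl

/-- The fluctuation block goes to `η₂` under the second embedding. [folklore] -/
theorem dblEta_trans_dblEmb₂ : (dblEta κ).trans (dblEmb₂ κ) = trpEta₂ κ := by
  ext k; rfl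

/-- Every generator outside the fluctuation block is in the variable block. [folklore] -/
theorem eq_dblPsi_of_not_mem_dblEta [Fintype κ] {j : DblIdx κ}
    (hj : j ∉ Finset.univ.map (dblEta κ).toEmbedding) : ∃ k, j = dblPsi κ k := by
  cases h : ofLex j with
  | inl k => exact ⟨k, by rw [← toLex_ofLex j, h]; rfl⟩
  | inr k =>
    refine absurd (Finset.mem_map.2 ⟨k, Finset.mem_univ _, ?_⟩) hj
    rw [← toLex_ofLex j, h]; rfl

/-- The three blocks of the tripled set: `ψ` and `η₁` are disjoint. [folklore] -/
theorem disjoint_trpPsi_trpEta₁ [Fintype κ] :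
    Disjoint (Finset.univ.map (trpPsi κ).toEmbedding) (Finset.univ.map (trpEta₁ κ).toEmbedding) := by
  refine Finset.disjoint_left.2 fun a ha hb => ?_
  obtain ⟨k, -, rfl⟩ := Finset.mem_map.1 ha
  obtain ⟨k', -, hk'⟩ := Finset.mem_map.1 hb
  exact Sum.inr_ne_inl (toLex.injective hk')

/-- The three blocks of the tripled set: `ψ` and `η₂` are disjoint. [folklore] -/
theorem disjoint_trpPsi_trpEta₂ [Fintype κ] :
    Disjoint (Finset.univ.map (trpPsi κ).toEmbedding) (Finset.univ.map (trpEta₂ κ).toEmbedding) := by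
  refine Finset.disjoint_left.2 fun a ha hb => ?_
  obtain ⟨k, -, rfl⟩ := Finset.mem_map.1 ha
  obtain ⟨k', -, hk'⟩ := Finset.mem_map.1 hb
  exact Sum.inr_ne_inl (toLex.injective hk')

/-- The three blocks of the tripled set: `η₁` precedes `η₂`. [folklore] -/
theorem trpEta₁_lt_trpEta₂ [Fintype κ] :
    ∀ x ∈ Finset.univ.map (trpEta₁ κ).toEmbedding, ∀ y ∈ Finset.univ.map (trpEta₂ κ).toEmbedding, x < y := by
  intro x hx y hy
  obtain ⟨k, -, rfl⟩ := Finset.mem_map.1 hx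
  obtain ⟨k', -, rfl⟩ := Finset.mem_map.1 hy
  exact Sum.Lex.inr_lt_inr_iff.2 (Sum.Lex.inl_lt_inr _ _)

/-- The embeddings send the variable block away from the fluctuation blocks. [folklore] -/
theorem dblEmb₁_not_mem_of_not_mem [Fintype κ] {j : DblIdx κ} (hj : j ∉ Finset.univ.map (dblEta κ).toEmbedding) :
    dblEmb₁ κ j ∉ Finset.univ.map (trpEta₁ κ).toEmbedding ∧ dblEmb₁ κ j ∉ Finset.univ.map (trpEta₂ κ).toEmbedding := by
  obtain ⟨k, rfl⟩ := eq_dblPsi_of_not_mem_dblEta κ hj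
  have h : dblEmb₁ κ (dblPsi κ k) ∈ Finset.univ.map (trpPsi κ).toEmbedding :=
    Finset.mem_map.2 ⟨k, Finset.mem_univ _, rfl⟩
  exact ⟨fun h' => Finset.disjoint_left.1 (disjoint_trpPsi_trpEta₁ κ) h h',
    fun h' => Finset.disjoint_left.1 (disjoint_trpPsi_trpEta₂ κ) h h'⟩

end Indices

section TwoBlocks

variable (R : Type*) [CommRing R] [Algebra ℚ R] {ι : Type*} [LinearOrder ι] [Fintype ι]

omit [Algebra ℚ R] in
/-- The two embeddings of the doubled algebra agree on forms without fluctuation fields. [folklore] -/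
theorem map_dblEmb₁_eq_map_dblEmb₂ {y : GrassmannAlgebra R (DblIdx ι)}
    (hy : y ∈ spectatorSubalgebra R (Finset.univ.map (dblEta ι).toEmbedding)) :
    ExteriorAlgebra.map (Function.ExtendByZero.linearMap R (dblEmb₁ ι)) y =
      ExteriorAlgebra.map (Function.ExtendByZero.linearMap R (dblEmb₂ ι)) y := by
  refine ringHom_eq_of_mem_spectatorSubalgebra R
    (f := (ExteriorAlgebra.map (Function.ExtendByZero.linearMap R (dblEmb₁ ι))).toRingHom)
    (g := (ExteriorAlgebra.map (Function.ExtendByZero.linearMap R (dblEmb₂ ι))).toRingHom)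
    (fun r => ?_) (fun j hj => ?_) hy
  · exact (AlgHom.commutes _ r).trans (AlgHom.commutes _ r).symm
  · obtain ⟨k, rfl⟩ := eq_dblPsi_of_not_mem_dblEta ι hj
    change ExteriorAlgebra.map _ (gen R (dblPsi ι k)) = ExteriorAlgebra.map _ (gen R (dblPsi ι k))
    rw [map_extendByZero_gen, map_extendByZero_gen]
    rfl

/-- **The fermionic convolution semigroup in the doubled algebra** (variable block `ψ = dblPsi`,
one fluctuation block `η = dblEta` used for both integrations): for `A⁻¹ = A₁⁻¹ + A₂⁻¹` (all
determinants units) and every `x` without `η`-fields,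
`Γ_{A₁}(Γ_{A₂} x) = (ε det A₁ det A₂ (det A)⁻¹) • Γ_A x`, `Γ_B x = ∫ dη̄dη e^{η̄Bη} x(ψ + η)` —
BBS 2015, Proposition 5.1 (`E_{C'+C₁}θ = E_{C'}θ ∘ E_{C₁}θ`), fermionic part, un-normalised; proved by
transport to three blocks. [cite: BauerschmidtBrydgesSlade2015LogCorr, §5.1, Proposition 5.1] -/
theorem gaussConvOn_gaussConvOn_dbl (A₁ A₂ A : Matrix ι ι R) (hA₁ : IsUnit A₁.det) (hA₂ : IsUnit A₂.det)
    (hA : IsUnit A.det) (hAinv : A⁻¹ = A₁⁻¹ + A₂⁻¹) {x : GrassmannAlgebra R (DblIdx ι)}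
    (hx : x ∈ spectatorSubalgebra R (Finset.univ.map (dblEta ι).toEmbedding)) :
    gaussConvOn R (dblPsi ι) (dblEta ι) A₁ (gaussConvOn R (dblPsi ι) (dblEta ι) A₂ x) =
      ((-1 : R) ^ (Fintype.card ι * (Fintype.card ι - 1) / 2) * A₁.det * A₂.det * Ring.inverse A.det) •
        gaussConvOn R (dblPsi ι) (dblEta ι) A x := by
  have hX₁ : ExteriorAlgebra.map (Function.ExtendByZero.linearMap R (dblEmb₁ ι)) x ∈
      spectatorSubalgebra R (Finset.univ.map (trpEta₁ ι).toEmbedding) :=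
    map_extendByZero_mem_spectatorSubalgebra_of_mem R (dblEmb₁ ι)
      (fun j hj => (dblEmb₁_not_mem_of_not_mem ι hj).1) hx
  have hX₂ : ExteriorAlgebra.map (Function.ExtendByZero.linearMap R (dblEmb₁ ι)) x ∈
      spectatorSubalgebra R (Finset.univ.map (trpEta₂ ι).toEmbedding) :=
    map_extendByZero_mem_spectatorSubalgebra_of_mem R (dblEmb₁ ι)
      (fun j hj => (dblEmb₁_not_mem_of_not_mem ι hj).2) hx
  apply map_extendByZero_injective R (dblEmb₁ ι).injective
  rw [map_extendByZero_gaussConvOn, map_dblEmb₁_eq_map_dblEmb₂ R (gaussConvOn_mem_self R _ _ A₂ x),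
    map_extendByZero_gaussConvOn, ← map_dblEmb₁_eq_map_dblEmb₂ R hx, map_smul, map_extendByZero_gaussConvOn,
    dblPsi_trans_dblEmb₁, dblEta_trans_dblEmb₁, dblPsi_trans_dblEmb₂, dblEta_trans_dblEmb₂]
  exact gaussConvOn_gaussConvOn R (trpPsi ι) (trpEta₁ ι) (trpEta₂ ι) (disjoint_trpPsi_trpEta₁ ι)
    (disjoint_trpPsi_trpEta₂ ι) (trpEta₁_lt_trpEta₂ ι) A₁ A₂ A hA₁ hA₂ hA hAinv hX₁ hX₂

end TwoBlocks

end QLatticeAQFT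

end Literature.MathematicalPhysics.QuantumLattice
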